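import Mathlib
import Summits.AtomisticToContinuum.FouriersLaw.Theorems.EmbeddedDrudeMourreMourreDissolutionContinuousDensityAssemblyAux
import Summits.AtomisticToContinuum.FouriersLaw.Theorems.EmbeddedDrudeMourreMourreDissolutionLevelShiftPushforward
import HarnessLib

/-!
# Continuity of the weighted two-phonon density of states near the threshold —
# `stub_continuousDensityAssembly` (stub ASM) of line `swap-odd-threshold-rigidity`
(crux `EmbeddedDrudeMourre.MourreDissolution`, item stmt-AtomisticToContinuum-12594; helper file, `--supports`)

Registered stub ASM of the checked skeleton of line `swap-odd-threshold-rigidity` (lead c9), in the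
skeleton's stub namespace `Summit.AtomisticToContinuum.FouriersLaw.Theorems.MourreDissolution`;
registered shape `GLUE → PER → REG → NC → CONT`.

Statement (CONT). For the pinned band `ω = dispersion ω₂` (`ω₂ > 0`), couplings `a, b`, a `2π`-periodic
`C³` profile `f`, the weight `W = Φ²/(ω₁ω₂ω₃ω₄)²·[f]²` (`Φ = vertex a b`,
`[f] = f(k₁)+f(k₂)−f(k₃)−f(k₁+k₂−k₃)`) and the pair resonance function `Ω = resonanceFn ω₂`, both
read at `p = (k₁,(k₃,k₂))` on the cell `(−π,π]³` (iterated product measure `dk₁(dk₃dk₂)`), the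
pushforward `m_f = Ω_*(W dk)` (the bracket-weighted two-phonon density of states) has a continuous
non-negative density on the window `(−δ, δ)`, `δ = √(ω₂+4) − √ω₂ = ω(π) − ω(0)`.

Hypotheses (the neighbouring stubs, verbatim): GLUE (density approximation: a finite measure that
splits, for every `ε`, into a part with a continuous window density and a part `≤ ε·Lebesgue` on
intervals has a continuous window density), PER (cell integral of a coordinatewise `2π`-periodic
`F` = integral of `ψF` on `ℝ³`, `ψ` the hat weight), REG (regular-value pushforward density for a
`C¹` map and a compactly supported continuous weight off whose support-critical-points the window
lies), NC (the weighted sublevel sets of `Ω` do not concentrate on the exchange slabs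
`{|sin((k₃−k₁)/2)| < η} ∪ {|sin((k₂−k₃)/2)| < η}`).

Proof (`contAsm_assembly`, abstract in `ψ, W, Ω`). `m_f` is finite (`levelShift_isFiniteMeasure_map`).
GLUE with, for `ε > 0`: `η` from NC and the continuous periodic slab cutoff `θ`
(`contAsm_exists_cutoff`, `= 0` where a half-angle sine is `≤ η/2` in modulus, `= 1` where both are
`≥ η`); `m₁ = Ω_*(θψW dp)`, `m₂ = Ω_*((1−θ)ψW dp)` on `ℝ³`.
* split `m_f = m₁ + m₂`: evaluate on a measurable `A` (`contAsm_map_withDensity_apply`), move the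
  cell integral of the periodic `1_A(Ω)·W` to `ℝ³` by PER, and split `ψW = θψW + (1−θ)ψW`;
* `m₁` by REG: `θψW` is continuous, `≥ 0`, compactly supported (`ψ` is), and on its topological
  support both half-angle sines are `≥ η/2`, whereas at a critical point of `Ω` in the window one
  of them vanishes — the regular-value check `contAsm_crit` of the Aux file: the three coordinate
  partials `v₁ − v₄`, `v₄ − v₃`, `v₂ − v₄` vanish, RL (`stub_regularLevels`) forces `Ω = 0`
  (`|Ω| ≤ δ < 2δ`), and A (`stub_pairThreshold`) gives `k₃ ≡ k₁` or `k₃ ≡ k₂ (mod 2π)`;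
* `m₂` by NC: `m₂(E−r,E+r) = ∫ ψ·1_{(E−r,E+r)}(Ω)(1−θ)W` goes back to the cell by PER, where
  `1_{(E−r,E+r)}(Ω)(1−θ)W ≤ 1_{slab_η}·1_{(E−r,E+r)}(Ω)W` pointwise (`θ = 1` off the slab).
Measure plumbing over Mathlib (`Measure.map_apply`, `withDensity_apply`, `lintegral_indicator`,
`Measure.restrict_restrict`, `Measure.prod_restrict`); no cited facts.
-/

noncomputable section

namespace Summit.AtomisticToContinuum.FouriersLaw.Theorems.MourreDissolution

open MeasureTheory Filter Set Function Topology
open scoped ENNReal NNReal Topology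
open Literature.MathematicalPhysics.KineticTheory
open Literature.MathematicalPhysics.KineticTheory.PhononBoltzmann

/-! ### The abstract assembly -/

/-- **The assembly, abstract form.** Given the density-approximation principle (GLUE), the
regular-value pushforward density (REG), a continuous compactly supported weight `ψ ≥ 0` periodising
the cell (PER), a continuous coordinatewise `2π`-periodic weight `W ≥ 0` and a `C¹` coordinatewise
`2π`-periodic `Ω` on `ℝ³` whose critical points with `|Ω| ≤ δ` lie on the exchange planes
`{sin((k₃−k₁)/2) = 0} ∪ {sin((k₂−k₃)/2) = 0}`, and the slab non-concentration bound (NC) for `(Ω, W)`,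
the pushforward `Ω_*(W dk)` of the cell `(−π,π]³` has a continuous non-negative density on `(−δ, δ)`.
For `ε > 0`: `η` from NC, the slab cutoff `θ` of `contAsm_exists_cutoff`; by PER
`Ω_*(W dk) = Ω_*(θψW dp) + Ω_*((1−θ)ψW dp)`; REG handles the first (on `tsupport θψW` both
half-angle sines are `≥ η/2`), NC the second (through PER backwards, `1 − θ ≤ 1_{slab}`). [folklore] -/
theorem contAsm_assembly
    (hGLUE : ∀ (m : MeasureTheory.Measure ℝ) (δ : ℝ), MeasureTheory.IsFiniteMeasure m → 0 < δ →
        (∀ ε : ℝ, 0 < ε → ∃ m₁ m₂ : MeasureTheory.Measure ℝ, m = m₁ + m₂ ∧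
          (∃ ρ₁ : ℝ → ℝ, ContinuousOn ρ₁ (Set.Ioo (-δ) δ) ∧ (∀ x ∈ Set.Ioo (-δ) δ, 0 ≤ ρ₁ x) ∧
            m₁.restrict (Set.Ioo (-δ) δ) =
              (volume.restrict (Set.Ioo (-δ) δ)).withDensity (fun x => ENNReal.ofReal (ρ₁ x))) ∧
          (∀ E r : ℝ, 0 < r → m₂ (Set.Ioo (E - r) (E + r)) ≤ ENNReal.ofReal (ε * r))) →
        ∃ ρ : ℝ → ℝ, ContinuousOn ρ (Set.Ioo (-δ) δ) ∧ (∀ x ∈ Set.Ioo (-δ) δ, 0 ≤ ρ x) ∧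
          m.restrict (Set.Ioo (-δ) δ) =
            (volume.restrict (Set.Ioo (-δ) δ)).withDensity (fun x => ENNReal.ofReal (ρ x)))
    (hREG : ∀ (Ω G : ℝ × ℝ × ℝ → ℝ) (δ₀ : ℝ), 0 < δ₀ → ContDiff ℝ 1 Ω → Continuous G →
        HasCompactSupport G → (∀ p, 0 ≤ G p) →
        (∀ p ∈ tsupport G, |Ω p| ≤ δ₀ → fderiv ℝ Ω p ≠ 0) →
        ∃ ρ : ℝ → ℝ, ContinuousOn ρ (Set.Ioo (-δ₀) δ₀) ∧ (∀ x ∈ Set.Ioo (-δ₀) δ₀, 0 ≤ ρ x) ∧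
          (MeasureTheory.Measure.map Ω (volume.withDensity fun p => ENNReal.ofReal (G p))).restrict
              (Set.Ioo (-δ₀) δ₀) =
            (volume.restrict (Set.Ioo (-δ₀) δ₀)).withDensity fun x => ENNReal.ofReal (ρ x))
    {ψ : ℝ × ℝ × ℝ → ℝ} (hψc : Continuous ψ) (hψ0 : ∀ p, 0 ≤ ψ p) (hψK : HasCompactSupport ψ)
    (hPER : ∀ F : ℝ × ℝ × ℝ → ENNReal, Measurable F →
        (∀ p : ℝ × ℝ × ℝ, F (p.1 + 2 * Real.pi, p.2) = F p) →
        (∀ p : ℝ × ℝ × ℝ, F (p.1, p.2.1 + 2 * Real.pi, p.2.2) = F p) →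
        (∀ p : ℝ × ℝ × ℝ, F (p.1, p.2.1, p.2.2 + 2 * Real.pi) = F p) →
        ∫⁻ p in Set.Ioc (-Real.pi) Real.pi ×ˢ (Set.Ioc (-Real.pi) Real.pi ×ˢ Set.Ioc (-Real.pi) Real.pi), F p =
          ∫⁻ p : ℝ × ℝ × ℝ, ENNReal.ofReal (ψ p) * F p)
    {W Ω : ℝ × ℝ × ℝ → ℝ} {δ : ℝ} (hδ : 0 < δ) (hWc : Continuous W) (hW0 : ∀ p, 0 ≤ W p)
    (hW₁ : ∀ p : ℝ × ℝ × ℝ, W (p.1 + 2 * Real.pi, p.2) = W p)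
    (hW₂ : ∀ p : ℝ × ℝ × ℝ, W (p.1, p.2.1 + 2 * Real.pi, p.2.2) = W p)
    (hW₃ : ∀ p : ℝ × ℝ × ℝ, W (p.1, p.2.1, p.2.2 + 2 * Real.pi) = W p)
    (hΩ : ContDiff ℝ 1 Ω)
    (hΩ₁ : ∀ p : ℝ × ℝ × ℝ, Ω (p.1 + 2 * Real.pi, p.2) = Ω p)
    (hΩ₂ : ∀ p : ℝ × ℝ × ℝ, Ω (p.1, p.2.1 + 2 * Real.pi, p.2.2) = Ω p)
    (hΩ₃ : ∀ p : ℝ × ℝ × ℝ, Ω (p.1, p.2.1, p.2.2 + 2 * Real.pi) = Ω p)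
    (hcrit : ∀ p : ℝ × ℝ × ℝ, |Ω p| ≤ δ → fderiv ℝ Ω p = 0 →
      Real.sin ((p.2.1 - p.1) / 2) = 0 ∨ Real.sin ((p.2.2 - p.2.1) / 2) = 0)
    (hNC : ∀ ε : ℝ, 0 < ε → ∃ η : ℝ, 0 < η ∧ ∀ E r : ℝ, 0 < r →
      ∫⁻ p in (Set.Ioc (-Real.pi) Real.pi ×ˢ (Set.Ioc (-Real.pi) Real.pi ×ˢ Set.Ioc (-Real.pi) Real.pi)) ∩
          {p : ℝ × ℝ × ℝ | |Real.sin ((p.2.1 - p.1) / 2)| < η ∨ |Real.sin ((p.2.2 - p.2.1) / 2)| < η},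
        (Set.Ioo (E - r) (E + r)).indicator (fun _ => (1 : ENNReal)) (Ω p) * ENNReal.ofReal (W p) ≤
        ENNReal.ofReal (ε * r)) :
    ∃ ρ : ℝ → ℝ, ContinuousOn ρ (Set.Ioo (-δ) δ) ∧ (∀ x ∈ Set.Ioo (-δ) δ, 0 ≤ ρ x) ∧
      (MeasureTheory.Measure.map Ω
          (((volume.restrict (Set.Ioc (-Real.pi) Real.pi)).prod
              ((volume.restrict (Set.Ioc (-Real.pi) Real.pi)).prod
                (volume.restrict (Set.Ioc (-Real.pi) Real.pi)))).withDensity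
            fun p => ENNReal.ofReal (W p))).restrict (Set.Ioo (-δ) δ) =
        (volume.restrict (Set.Ioo (-δ) δ)).withDensity fun x => ENNReal.ofReal (ρ x) := by
  have hΩc : Continuous Ω := hΩ.continuous
  have hΩm : Measurable Ω := hΩc.measurable
  refine hGLUE _ δ (levelShift_isFiniteMeasure_map Ω hWc) hδ fun ε hε => ?_
  obtain ⟨η, hη, hNCb⟩ := hNC ε hε
  obtain ⟨θ, hθc, hθ0, hθ1, hθ₁, hθ₂, hθ₃, hθsupp, hθone⟩ := contAsm_exists_cutoff hη
  -- measurability of the integrands `1_A(Ω) · ofReal g`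
  have hmeas : ∀ {A : Set ℝ}, MeasurableSet A → ∀ {g : ℝ × ℝ × ℝ → ℝ}, Continuous g →
      Measurable fun p => A.indicator (fun _ => (1 : ℝ≥0∞)) (Ω p) * ENNReal.ofReal (g p) :=
    fun hA g hg => ((measurable_const.indicator hA).comp hΩm).mul hg.measurable.ennreal_ofReal
  have hG₁c : Continuous fun p => θ p * (ψ p * W p) := hθc.mul (hψc.mul hWc)
  have hG₂c : Continuous fun p => (1 - θ p) * (ψ p * W p) :=
    (continuous_const.sub hθc).mul (hψc.mul hWc)
  have hG₁0 : ∀ p, 0 ≤ θ p * (ψ p * W p) := fun p => mul_nonneg (hθ0 p) (mul_nonneg (hψ0 p) (hW0 p))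
  have hG₂0 : ∀ p, 0 ≤ (1 - θ p) * (ψ p * W p) := fun p =>
    mul_nonneg (sub_nonneg.2 (hθ1 p)) (mul_nonneg (hψ0 p) (hW0 p))
  refine ⟨Measure.map Ω (volume.withDensity fun p => ENNReal.ofReal (θ p * (ψ p * W p))),
    Measure.map Ω (volume.withDensity fun p => ENNReal.ofReal ((1 - θ p) * (ψ p * W p))),
    ?_, ?_, ?_⟩
  · -- the split `Ω_*(W dk) = Ω_*(θψW dp) + Ω_*((1−θ)ψW dp)` (PER)
    ext A hA
    simp only [Measure.add_apply, contAsm_map_withDensity_apply hΩm _ hA]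
    rw [contAsm_cell_measure, hPER _ (hmeas hA hWc) (fun p => by simp only [hΩ₁, hW₁])
      (fun p => by simp only [hΩ₂, hW₂]) (fun p => by simp only [hΩ₃, hW₃]),
      ← lintegral_add_left (hmeas hA hG₁c)]
    refine lintegral_congr fun p => ?_
    have hsum : θ p * (ψ p * W p) + (1 - θ p) * (ψ p * W p) = ψ p * W p := by ring
    rw [← mul_add, ← ENNReal.ofReal_add (hG₁0 p) (hG₂0 p), hsum, ENNReal.ofReal_mul (hψ0 p)]
    ring
  · -- the regular part (REG)
    refine hREG Ω _ δ hδ hΩ hG₁c (hψK.mul_right.mul_left) hG₁0 fun p hp hΩp hfd => ?_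
    have hsub : tsupport (fun p => θ p * (ψ p * W p)) ⊆
        {p : ℝ × ℝ × ℝ | η / 2 ≤ |Real.sin ((p.2.1 - p.1) / 2)|} ∩
          {p : ℝ × ℝ × ℝ | η / 2 ≤ |Real.sin ((p.2.2 - p.2.1) / 2)|} :=
      closure_minimal (fun q hq => hθsupp q (left_ne_zero_of_mul hq))
        ((isClosed_le continuous_const (by fun_prop)).inter
          (isClosed_le continuous_const (by fun_prop)))
    obtain ⟨h1, h2⟩ := hsub hp
    simp only [mem_setOf_eq] at h1 h2
    rcases hcrit p hΩp hfd with h | h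
    · rw [h, abs_zero] at h1
      linarith
    · rw [h, abs_zero] at h2
      linarith
  · -- the slab part (NC through PER backwards)
    intro E r hr
    have hslab : MeasurableSet {p : ℝ × ℝ × ℝ | |Real.sin ((p.2.1 - p.1) / 2)| < η ∨
        |Real.sin ((p.2.2 - p.2.1) / 2)| < η} := by
      rw [setOf_or]
      refine MeasurableSet.union ?_ ?_
      · exact measurableSet_lt (f := fun p : ℝ × ℝ × ℝ => |Real.sin ((p.2.1 - p.1) / 2)|)
          (by fun_prop) measurable_const
      · exact measurableSet_lt (f := fun p : ℝ × ℝ × ℝ => |Real.sin ((p.2.2 - p.2.1) / 2)|)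
          (by fun_prop) measurable_const
    have hG₃c : Continuous fun p => (1 - θ p) * W p := by fun_prop
    rw [contAsm_map_withDensity_apply hΩm _ measurableSet_Ioo]
    calc ∫⁻ p, (Ioo (E - r) (E + r)).indicator (fun _ => (1 : ℝ≥0∞)) (Ω p) *
          ENNReal.ofReal ((1 - θ p) * (ψ p * W p))
        = ∫⁻ p, ENNReal.ofReal (ψ p) * ((Ioo (E - r) (E + r)).indicator (fun _ => (1 : ℝ≥0∞)) (Ω p) *
            ENNReal.ofReal ((1 - θ p) * W p)) := by
          refine lintegral_congr fun p => ?_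
          rw [show (1 - θ p) * (ψ p * W p) = ψ p * ((1 - θ p) * W p) by ring,
            ENNReal.ofReal_mul (hψ0 p)]
          ring
      _ = ∫⁻ p in Ioc (-Real.pi) Real.pi ×ˢ (Ioc (-Real.pi) Real.pi ×ˢ Ioc (-Real.pi) Real.pi),
            (Ioo (E - r) (E + r)).indicator (fun _ => (1 : ℝ≥0∞)) (Ω p) *
              ENNReal.ofReal ((1 - θ p) * W p) :=
          (hPER _ (hmeas measurableSet_Ioo hG₃c)
            (fun p => by simp only [hΩ₁, hW₁, hθ₁]) (fun p => by simp only [hΩ₂, hW₂, hθ₂])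
            (fun p => by simp only [hΩ₃, hW₃, hθ₃])).symm
      _ ≤ ∫⁻ p in Ioc (-Real.pi) Real.pi ×ˢ (Ioc (-Real.pi) Real.pi ×ˢ Ioc (-Real.pi) Real.pi),
            {p : ℝ × ℝ × ℝ | |Real.sin ((p.2.1 - p.1) / 2)| < η ∨
                |Real.sin ((p.2.2 - p.2.1) / 2)| < η}.indicator
              (fun p => (Ioo (E - r) (E + r)).indicator (fun _ => (1 : ℝ≥0∞)) (Ω p) *
                ENNReal.ofReal (W p)) p := by
          refine lintegral_mono fun p => ?_
          by_cases hp : p ∈ {p : ℝ × ℝ × ℝ | |Real.sin ((p.2.1 - p.1) / 2)| < η ∨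
              |Real.sin ((p.2.2 - p.2.1) / 2)| < η}
          · rw [indicator_of_mem hp]
            exact mul_le_mul_right (ENNReal.ofReal_le_ofReal
              (mul_le_of_le_one_left (hW0 p) (by linarith [hθ0 p]))) _
          · rw [indicator_of_notMem hp]
            simp only [mem_setOf_eq, not_or, not_lt] at hp
            simp [hθone p hp.1 hp.2]
      _ = ∫⁻ p in (Ioc (-Real.pi) Real.pi ×ˢ (Ioc (-Real.pi) Real.pi ×ˢ Ioc (-Real.pi) Real.pi)) ∩
            {p : ℝ × ℝ × ℝ | |Real.sin ((p.2.1 - p.1) / 2)| < η ∨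
                |Real.sin ((p.2.2 - p.2.1) / 2)| < η},
            (Ioo (E - r) (E + r)).indicator (fun _ => (1 : ℝ≥0∞)) (Ω p) * ENNReal.ofReal (W p) := by
          rw [lintegral_indicator hslab, Measure.restrict_restrict hslab, inter_comm]
      _ ≤ ENNReal.ofReal (ε * r) := hNCb E r hr

/-! ### The registered stub -/

/-- **Stub ASM of line `swap-odd-threshold-rigidity` (`stub_continuousDensityAssembly`), registered
shape `GLUE → PER → REG → NC → CONT`.** Assuming the density-approximation principle (GLUE), the
periodisation identity (PER), the regular-value pushforward density (REG) and the slab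
non-concentration estimate (NC): for `ω₂ > 0`, any couplings `a, b` and every `2π`-periodic `C³`
profile `f`, the bracket-weighted two-phonon density of states `m_f = Ω_*(W dk)` — the pushforward of
`W = Φ²/(ω₁ω₂ω₃ω₄)²·[f]²` on the cell `(−π,π]³` (read at `p = (k₁,(k₃,k₂))`) under the pair
resonance function `Ω` — has a continuous non-negative density on the window
`(−δ, δ)`, `δ = √(ω₂+4) − √ω₂`. Assembly `contAsm_assembly` with the regular-value check
`contAsm_crit` (RL `stub_regularLevels` + A `stub_pairThreshold`). [folklore] -/
theorem stub_continuousDensityAssembly :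
    (∀ (m : MeasureTheory.Measure ℝ) (δ : ℝ), MeasureTheory.IsFiniteMeasure m → 0 < δ →
        (∀ ε : ℝ, 0 < ε → ∃ m₁ m₂ : MeasureTheory.Measure ℝ, m = m₁ + m₂ ∧
          (∃ ρ₁ : ℝ → ℝ, ContinuousOn ρ₁ (Set.Ioo (-δ) δ) ∧ (∀ x ∈ Set.Ioo (-δ) δ, 0 ≤ ρ₁ x) ∧
            m₁.restrict (Set.Ioo (-δ) δ) =
              (volume.restrict (Set.Ioo (-δ) δ)).withDensity (fun x => ENNReal.ofReal (ρ₁ x))) ∧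
          (∀ E r : ℝ, 0 < r → m₂ (Set.Ioo (E - r) (E + r)) ≤ ENNReal.ofReal (ε * r))) →
        ∃ ρ : ℝ → ℝ, ContinuousOn ρ (Set.Ioo (-δ) δ) ∧ (∀ x ∈ Set.Ioo (-δ) δ, 0 ≤ ρ x) ∧
          m.restrict (Set.Ioo (-δ) δ) =
            (volume.restrict (Set.Ioo (-δ) δ)).withDensity (fun x => ENNReal.ofReal (ρ x))) →
    (∀ F : ℝ × ℝ × ℝ → ENNReal, Measurable F →
        (∀ p : ℝ × ℝ × ℝ, F (p.1 + 2 * Real.pi, p.2) = F p) →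
        (∀ p : ℝ × ℝ × ℝ, F (p.1, p.2.1 + 2 * Real.pi, p.2.2) = F p) →
        (∀ p : ℝ × ℝ × ℝ, F (p.1, p.2.1, p.2.2 + 2 * Real.pi) = F p) →
        ∫⁻ p in Set.Ioc (-Real.pi) Real.pi ×ˢ (Set.Ioc (-Real.pi) Real.pi ×ˢ Set.Ioc (-Real.pi) Real.pi), F p =
          ∫⁻ p : ℝ × ℝ × ℝ, ENNReal.ofReal (max 0 (1 - |p.1| / (2 * Real.pi)) *
            (max 0 (1 - |p.2.1| / (2 * Real.pi)) * max 0 (1 - |p.2.2| / (2 * Real.pi)))) * F p) →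
    (∀ (Ω G : ℝ × ℝ × ℝ → ℝ) (δ₀ : ℝ), 0 < δ₀ → ContDiff ℝ 1 Ω → Continuous G → HasCompactSupport G →
        (∀ p, 0 ≤ G p) →
        (∀ p ∈ tsupport G, |Ω p| ≤ δ₀ → fderiv ℝ Ω p ≠ 0) →
        ∃ ρ : ℝ → ℝ, ContinuousOn ρ (Set.Ioo (-δ₀) δ₀) ∧ (∀ x ∈ Set.Ioo (-δ₀) δ₀, 0 ≤ ρ x) ∧
          (MeasureTheory.Measure.map Ω (volume.withDensity fun p => ENNReal.ofReal (G p))).restrict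
              (Set.Ioo (-δ₀) δ₀) =
            (volume.restrict (Set.Ioo (-δ₀) δ₀)).withDensity fun x => ENNReal.ofReal (ρ x)) →
    (∀ ω₂ a b : ℝ, 0 < ω₂ → ∀ f : ℝ → ℝ, Function.Periodic f (2 * Real.pi) → ContDiff ℝ 2 f →
        ∀ ε : ℝ, 0 < ε → ∃ η : ℝ, 0 < η ∧ ∀ E r : ℝ, 0 < r →
          ∫⁻ p in (Set.Ioc (-Real.pi) Real.pi ×ˢ (Set.Ioc (-Real.pi) Real.pi ×ˢ Set.Ioc (-Real.pi) Real.pi)) ∩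
              {p : ℝ × ℝ × ℝ | |Real.sin ((p.2.1 - p.1) / 2)| < η ∨ |Real.sin ((p.2.2 - p.2.1) / 2)| < η},
            (Set.Ioo (E - r) (E + r)).indicator (fun _ => (1 : ENNReal)) (resonanceFn ω₂ p.1 p.2.2 p.2.1) *
              ENNReal.ofReal (vertex a b p.1 p.2.2 p.2.1 ^ 2 /
                  (dispersion ω₂ p.1 * dispersion ω₂ p.2.2 * dispersion ω₂ p.2.1 *
                    dispersion ω₂ (p.1 + p.2.2 - p.2.1)) ^ 2 *
                (f p.1 + f p.2.2 - f p.2.1 - f (p.1 + p.2.2 - p.2.1)) ^ 2) ≤ ENNReal.ofReal (ε * r)) →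
    ∀ ω₂ a b : ℝ, 0 < ω₂ → ∀ f : ℝ → ℝ, Function.Periodic f (2 * Real.pi) → ContDiff ℝ 3 f →
        ∃ δ : ℝ, 0 < δ ∧ ∃ ρ : ℝ → ℝ, ContinuousOn ρ (Set.Ioo (-δ) δ) ∧ (∀ x ∈ Set.Ioo (-δ) δ, 0 ≤ ρ x) ∧
          ((MeasureTheory.Measure.map (fun p : ℝ × ℝ × ℝ => resonanceFn ω₂ p.1 p.2.2 p.2.1)
              (((volume.restrict (Set.Ioc (-Real.pi) Real.pi)).prod
                  ((volume.restrict (Set.Ioc (-Real.pi) Real.pi)).prod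
                    (volume.restrict (Set.Ioc (-Real.pi) Real.pi)))).withDensity
                (fun p : ℝ × ℝ × ℝ => ENNReal.ofReal
                  (vertex a b p.1 p.2.2 p.2.1 ^ 2 /
                      (dispersion ω₂ p.1 * dispersion ω₂ p.2.2 * dispersion ω₂ p.2.1 *
                        dispersion ω₂ (p.1 + p.2.2 - p.2.1)) ^ 2 *
                    (f p.1 + f p.2.2 - f p.2.1 - f (p.1 + p.2.2 - p.2.1)) ^ 2))))).restrict (Set.Ioo (-δ) δ) =
            (volume.restrict (Set.Ioo (-δ) δ)).withDensity (fun x => ENNReal.ofReal (ρ x)) := by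
  intro hGLUE hPER hREG hNC ω₂ a b hω f hper hf
  have hδ := contAsm_delta_pos hω
  have hfc : Continuous f := hf.continuous
  refine ⟨_, hδ, ?_⟩
  -- the weight: continuity, sign, periodicity
  have hden : ∀ p : ℝ × ℝ × ℝ, (dispersion ω₂ p.1 * dispersion ω₂ p.2.2 * dispersion ω₂ p.2.1 *
      dispersion ω₂ (p.1 + p.2.2 - p.2.1)) ^ 2 ≠ 0 := fun p =>
    pow_ne_zero _ (mul_pos (mul_pos (mul_pos (dispersion_pos hω _) (dispersion_pos hω _))
      (dispersion_pos hω _)) (dispersion_pos hω _)).ne'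
  have hV : Continuous fun p : ℝ × ℝ × ℝ => vertex a b p.1 p.2.2 p.2.1 ^ 2 := by fun_prop
  have hD : Continuous fun p : ℝ × ℝ × ℝ => (dispersion ω₂ p.1 * dispersion ω₂ p.2.2 *
      dispersion ω₂ p.2.1 * dispersion ω₂ (p.1 + p.2.2 - p.2.1)) ^ 2 := by fun_prop
  have hB : Continuous fun p : ℝ × ℝ × ℝ =>
      (f p.1 + f p.2.2 - f p.2.1 - f (p.1 + p.2.2 - p.2.1)) ^ 2 := by fun_prop
  have hp := dispersion_periodic ω₂
  refine contAsm_assembly hGLUE hREG contAsm_psi_continuous contAsm_psi_nonneg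
    contAsm_psi_hasCompactSupport hPER hδ ((hV.div hD hden).mul hB) (fun p => by positivity)
    (fun p => ?_) (fun p => ?_) (fun p => ?_) (contAsm_contDiff_resonanceFn hω)
    (fun p => (contAsm_resonanceFn_periodic ω₂ _ _ _).1)
    (fun p => (contAsm_resonanceFn_periodic ω₂ _ _ _).2.2)
    (fun p => (contAsm_resonanceFn_periodic ω₂ _ _ _).2.1) (contAsm_crit ω₂ hω)
    (hNC ω₂ a b hω f hper (hf.of_le (by norm_num)))
  · dsimp only
    rw [(contAsm_vertex_periodic a b _ _ _).1, hp, hper,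
      show p.1 + 2 * Real.pi + p.2.2 - p.2.1 = p.1 + p.2.2 - p.2.1 + 2 * Real.pi by ring, hp, hper]
  · dsimp only
    rw [(contAsm_vertex_periodic a b _ _ _).2.2, hp, hper,
      show p.1 + p.2.2 - (p.2.1 + 2 * Real.pi) = p.1 + p.2.2 - p.2.1 - 2 * Real.pi by ring, hp.sub_eq,
      hper.sub_eq]
  · dsimp only
    rw [(contAsm_vertex_periodic a b _ _ _).2.1, hp, hper,
      show p.1 + (p.2.2 + 2 * Real.pi) - p.2.1 = p.1 + p.2.2 - p.2.1 + 2 * Real.pi by ring, hp, hper]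

end Summit.AtomisticToContinuum.FouriersLaw.Theorems.MourreDissolution

end
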